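/-
Origin: expansion seat `planner-pub-hodgecm-toy-g4-0`, handover #6 2026-08-18T13:31:15Z (md5 f5057e16) (`HOME/pub-hodgecm-toy-g4/lean/ToyG4/FundClass3.lean`, md5 f5057e16, 103 lines);
landed by the gen-8 packager in gate run 30 as `HodgeCM/Model/ToyG2/FundClass3.lean` (import ^import ToyG4\.GeometricAll3[ \t]*$→import HodgeCM.Model.ToyG2.GeometricAll3 ×1).
-/
/-
Copyright (c) 2026. All rights reserved.
Released under Apache 2.0 license as described in the file LICENSE.
-/
import Summits.HodgeConjecture.HodgeCM.StubTree.Qw8Milne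
import Summits.HodgeConjecture.HodgeCM.Proofs.Pohlmann.DegreeZero
import Summits.HodgeConjecture.HodgeCM.Model.Toy.ToyPadH0Fund
import Summits.HodgeConjecture.HodgeCM.Model.ToyG2.GeometricAll3

/-!
# N5 `Fact_fundClass` in the generation-3 toy universe, jointly with everything else

Seat `planner-pub-hodgecm-toy-g4-0` (EXPANSION part (e), CONSISTENCY WITNESS, generation 4), file 6.

The candidate fact N5 `Universe.Fact_fundClass` (`∀ X, alg X 0 = ⊤`, `StubTree/Qw8Milne.lean`) is the alternative degree-0 input
of the end states `Assembly.COR_CM_of_geometricFacts_fundClass` / `COR_CM_of_geometricFacts_zero` (via `Qw8MilneZero`).  Generation 1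
decided it in isolation (`Toy.toyModel_fact_fundClass`; refuted in the MA-model `h0PadModel`, `Toy.not_h0PadModel_fact_fundClass`,
`Model/Toy/ToyPadH0Fund.lean`).  Here (KERNEL; nothing cited, posited or hypothesised; no package statement edited):

* `fact3_fundClass_of_hodge_F0` / `fact3_fundClass (T pl)`: N5 holds in `toyModel3With exteriorHodgeData T pl` (the model decrees
  `alg := Hodge classes`; in ANY universe N4 `Fact_hodge_F0` makes every degree-0 class a Hodge class — pohl's
  `Universe.hodgeClassesOf_zero_eq_top`, `Proofs/Pohlmann/DegreeZero.lean`, by name — and N4 holds there, toy-g3's `fact3_hodge_F0`)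
  — for EVERY trace system and block datum;
* `toyUniverse₃_fundClass (d t)`, `toyUniverse₃_qw8MilneZero (d t)` (qw8b's `qw8MilneZero_of_fundClass`);
* the two remaining degree-0 end states APPLIED in the model: `toyUniverse₃_hcCM_by_geometricFacts_fundClass`,
  `toyUniverse₃_hcCM_by_geometricFacts_zero` (`1 ≤ d`, `t² = 16`);
* **`exists_openInputsGeometric_and_fundClass : ∃ U, U.ModelAxioms ∧ U.OpenInputsGeometric ∧ U.Fact_fundClass`** and
  **`fundClass_independent_of_openInputsGeometric`**: N5 is NOT decided by `ModelAxioms` — positive model `toyUniverse₃ 1 4` (with the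
  complete geometric record), negative model gen-1's `h0PadModel` (by name).

A consistency / non-vacuity statement about the package's own hypothesis lists in a toy model; says nothing about complex projective
varieties.
-/

noncomputable section


namespace HodgeCM

namespace ToyG2

open Toy Universe

section Model

variable (D : HodgeData) (T : TraceSys) (pl : GBlocks)

/-- In the generation-2/3 toy universe `alg X p` IS `hodgeClassesOf X p` (the model decrees every Hodge class algebraic). -/
theorem alg_eq_hodgeClassesOf₃ (X : GObj) (p : ℕ) :
    (toyModel3With D T pl).alg X p = (toyModel3With D T pl).hodgeClassesOf X p := rfl

/-- N5 `Fact_fundClass` in `toyModel3With D T pl` from N4 `Fact_hodge_F0` there (any Hodge data). -/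
theorem fact3_fundClass_of_hodge_F0 (h : (toyModel3With D T pl).Fact_hodge_F0) : (toyModel3With D T pl).Fact_fundClass :=
  fun X => (alg_eq_hodgeClassesOf₃ D T pl X 0).trans (Universe.hodgeClassesOf_zero_eq_top h X)

/-- **N5 `Fact_fundClass` holds in `toyModel3With exteriorHodgeData T pl`** (toy-g3's N4 `fact3_hodge_F0`), every `T`, `pl`. -/
theorem fact3_fundClass : (toyModel3With exteriorHodgeData T pl).Fact_fundClass :=
  fact3_fundClass_of_hodge_F0 exteriorHodgeData T pl (fact3_hodge_F0 T pl)

end Model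

section ToyUniverse

variable (d t : ℚ)

/-- N5 in the universe of record `toyUniverse₃ d t` (all `d t`). -/
theorem toyUniverse₃_fundClass : (toyUniverse₃ d t).Fact_fundClass := fact3_fundClass traceSys (gplOf d t)

/-- `Qw8MilneZero` in `toyUniverse₃ d t` (qw8b's `Universe.qw8MilneZero_of_fundClass`). -/
theorem toyUniverse₃_qw8MilneZero : (toyUniverse₃ d t).Qw8MilneZero :=
  Universe.qw8MilneZero_of_fundClass (toyUniverse₃_fundClass d t)

/-- **COR-CM in `toyUniverse₃ d t` by `Assembly.COR_CM_of_geometricFacts_fundClass`** (binders `ModelAxioms`, `RealisationExistsFace`,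
N1–N4, F2, F4, F5, F6, F7, N5 — every one witnessed). -/
theorem toyUniverse₃_hcCM_by_geometricFacts_fundClass (hd : 1 ≤ d) (ht : t ^ 2 = 16) : (toyUniverse₃ d t).HC_CM := by
  obtain ⟨hM, -, hR, h1, h2, h3, h4, hF2, hF4, hF5, hF6, hF7, -, -, -⟩ := toyUniverse₃_geometricFacts_all d t hd ht
  exact Assembly.COR_CM_of_geometricFacts_fundClass _ hM hR h1 h2 h3 h4 hF2 hF4 hF5 hF6 hF7 (toyUniverse₃_fundClass d t)

/-- **COR-CM in `toyUniverse₃ d t` by `Assembly.COR_CM_of_geometricFacts_zero`** (binders `ModelAxioms`, `RealisationExistsFace`,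
N1–N4, F2, F4, F5, F6, F7, `Qw8MilneZero` — every one witnessed). -/
theorem toyUniverse₃_hcCM_by_geometricFacts_zero (hd : 1 ≤ d) (ht : t ^ 2 = 16) : (toyUniverse₃ d t).HC_CM := by
  obtain ⟨hM, -, hR, h1, h2, h3, h4, hF2, hF4, hF5, hF6, hF7, -, -, -⟩ := toyUniverse₃_geometricFacts_all d t hd ht
  exact Assembly.COR_CM_of_geometricFacts_zero _ hM hR h1 h2 h3 h4 hF2 hF4 hF5 hF6 hF7 (toyUniverse₃_qw8MilneZero d t)

end ToyUniverse

/-- **N5 jointly with the complete geometric record**: one model of all 28 `ModelAxioms` with `OpenInputsGeometric` AND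
`Fact_fundClass` (witness `toyUniverse₃ 1 4`). -/
theorem exists_openInputsGeometric_and_fundClass :
    ∃ U : Universe, U.ModelAxioms ∧ U.OpenInputsGeometric ∧ U.Fact_fundClass :=
  ⟨toyUniverse₃ 1 4, toyUniverse₃_modelAxioms_all 1 4, toyUniverse₃_openInputsGeometric_all 1 4 le_rfl (by norm_num),
    toyUniverse₃_fundClass 1 4⟩

/-- **N5 is independent of `ModelAxioms`, the positive side carrying the complete geometric record**: `toyUniverse₃ 1 4`
(MA ∧ OpenInputsGeometric ∧ N5) versus gen-1's `h0PadModel` (MA ∧ ¬N5, `Toy.h0PadModel_modelAxioms`, `Toy.not_h0PadModel_fact_fundClass`). -/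
theorem fundClass_independent_of_openInputsGeometric :
    (∃ U : Universe, U.ModelAxioms ∧ U.OpenInputsGeometric ∧ U.Fact_fundClass) ∧
      ∃ U : Universe, U.ModelAxioms ∧ ¬ U.Fact_fundClass :=
  ⟨exists_openInputsGeometric_and_fundClass, Toy.h0PadModel, Toy.h0PadModel_modelAxioms, Toy.not_h0PadModel_fact_fundClass⟩

end ToyG2

end HodgeCM
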